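import Summits.BirchSwinnertonDyer.BirchSwinnertonDyer.Theorems.ByReductionTypeAtTwoSupersingularFlatBlindKummerLineTools
import Literature.NumberTheory.EllipticCurves.LocalKummerMap
import HarnessLib

/-!
# Route `ByReductionTypeAtTwo` (rung K4), crux `SupersingularRankZeroAtTwo` (item stmt-BirchSwinnertonDyer-19097), line
# `odd_blind_package`, slot 5 CDC_H, binder (hglob)/(P2) of the position glue (★★ p816472): **THE KUMMER LINE AT `p`** —
# `Kum_J(E)_v = κ_v(E(ℚ_v))` is CYCLIC of order `p^J`, generated by `κ_v(Q₁)` for a local point with `λ(Q₁) = 1`, and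
# `κ_v(Q) = m • κ_v(Q₁)` with `m ≡ λ(Q) (mod p^J)` (cell `bsd-2adic`, LEAD ss-1 GEN 21; memo `HOME/ss/gen21/HAND-TARGETS-CDC-4.md` 4c)

HONEST FRAMING: THEOREMS ONLY (no definition, no named fact, no `sorry`); the objects `C = Kum_J(E)_v`, `u = κ_v(Q₁)` of the abstract
position core (★ p816628) for the (P2) hand, from the Kummer-line tools (★ p816824: the two models `E(ℚ_v) ≃ E(ℚ_p)`, the `λ`-algebra) and
the tree's local Kummer sequence (`range_localKummerMap`, `ker_localKummerMap`, `LocalKummerMap.lean`). Hypotheses: `E(ℚ_v)[p] = 0` and a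
normalised functional `λ : E(ℚ_p) ↠ ℤ_p` killing exactly the torsion (for the twist `W₂` at `p = 2`: ★ p814209). Nothing is booked; 19097 stays
OPEN; BSD is proved for no curve. bears_on: K4 (19097). References: [SilvermanAEC2009] VII.6.3, VIII.§2, X.§4 (**); [MilneADT2006] I Lemma 3.3.
-/

set_option autoImplicit false
set_option linter.dupNamespace false

noncomputable section

open scoped Classical NumberField

namespace Summit.BirchSwinnertonDyer.BirchSwinnertonDyer.Theorems

namespace OddBlindLocal

open NumberField IsDedekindDomain WeierstrassCurve

/-- **The Kummer line at `p`.** For `E/ℚ`, a prime `p`, the place `v ∋ p`, `E(ℚ_v)[p] = 0`, and a functional `λ : E(ℚ_p) ↠ ℤ_p` with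
`ker λ = E(ℚ_p)_tors`: for every level `p^J` there are an identification `e : E(ℚ_v) ≃ E(ℚ_p)` compatible with base change from `ℚ` and a
local point `Q₁` with `λ(e Q₁) = 1` such that the local Kummer class `κ_v(Q₁) ∈ H¹(ℚ_v, E[p^J])` has order `p^J`, generates the local
Kummer condition `Kum_J(E)_v`, and `κ_v(Q) = m • κ_v(Q₁)` with `p^J ∣ λ(e Q) − m` for every `Q ∈ E(ℚ_v)`.
[cite: SilvermanAEC2009, VII.6.3 and X.§4 diagram (**)] [cite: MilneADT2006, I Lemma 3.3] -/
theorem exists_kummerLine_generator (E : WeierstrassCurve ℚ) [E.IsElliptic] {p : ℕ} [hp : Fact p.Prime]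
    {v : HeightOneSpectrum (𝓞 ℚ)} (hpv : (p : 𝓞 ℚ) ∈ v.asIdeal)
    (h0v : ∀ P : (E.baseChange (v.adicCompletion ℚ)).toAffine.Point, p • P = 0 → P = 0)
    (lam : (E.baseChange ℚ_[p]).toAffine.Point →+ ℤ_[p]) (hlam : ∀ X, lam X = 0 ↔ IsOfFinAddOrder X)
    (hsurj : Function.Surjective lam) (J : ℕ) (hn : ((p ^ J : ℕ) : ℤ) ≠ 0) :
    ∃ (e : (E.baseChange (v.adicCompletion ℚ)).toAffine.Point ≃+ (E.baseChange ℚ_[p]).toAffine.Point)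
      (Q₁ : (E.baseChange (v.adicCompletion ℚ)).toAffine.Point),
      (∀ P : E.toAffine.Point,
        e (Affine.Point.baseChange (W' := E) ℚ (v.adicCompletion ℚ) P) = Affine.Point.baseChange (W' := E) ℚ ℚ_[p] P) ∧
      lam (e Q₁) = 1 ∧
      addOrderOf (E.localKummerMap (v.adicCompletion ℚ) hn Q₁) = p ^ J ∧
      (∀ y ∈ E.kummerLocalConditionAt ((p ^ J : ℕ) : ℤ) (v.adicCompletion ℚ),
        y ∈ AddSubgroup.zmultiples (E.localKummerMap (v.adicCompletion ℚ) hn Q₁)) ∧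
      (∀ Q : (E.baseChange (v.adicCompletion ℚ)).toAffine.Point, ∃ m : ℤ,
        E.localKummerMap (v.adicCompletion ℚ) hn Q = m • E.localKummerMap (v.adicCompletion ℚ) hn Q₁ ∧
        (p : ℤ_[p]) ^ J ∣ lam (e Q) - m) := by
  obtain ⟨e, he⟩ := exists_pointAddEquiv_adicCompletion_padic_baseChange E hpv
  -- the functional read on `E(ℚ_v)`
  set lamv : (E.baseChange (v.adicCompletion ℚ)).toAffine.Point →+ ℤ_[p] := lam.comp e.toAddMonoidHom with hlamv_def
  have hlamv_apply : ∀ a, lamv a = lam (e a) := fun a ↦ rfl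
  have hlamv : ∀ a, lamv a = 0 ↔ IsOfFinAddOrder a := fun a ↦ by
    rw [hlamv_apply, hlam]
    constructor
    · intro h
      have h' := e.symm.toAddMonoidHom.isOfFinAddOrder h
      simpa using h'
    · exact fun h ↦ e.toAddMonoidHom.isOfFinAddOrder h
  have hsurjv : Function.Surjective lamv := fun x ↦ by
    obtain ⟨X, hX⟩ := hsurj x
    exact ⟨e.symm X, by rw [hlamv_apply, AddEquiv.apply_symm_apply, hX]⟩
  obtain ⟨Q₁, hQ₁⟩ := hsurjv 1
  set κ := E.localKummerMap (v.adicCompletion ℚ) hn with hκ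
  -- characteristic zero of `ℚ_v` (needed by the local Kummer sequence); introduced only now, so that no `E.baseChange ℚ_v`
  -- above is elaborated through `DivisionRing.toRatAlgebra`
  haveI : CharZero (v.adicCompletion ℚ) := charZero_of_injective_algebraMap (algebraMap ℚ (v.adicCompletion ℚ)).injective
  -- (K1) `κ a = 0 ↔ a ∈ p^J E(ℚ_v)`
  have hK1 : ∀ a, κ a = 0 ↔ ∃ b, a = p ^ J • b := fun a ↦ by
    rw [← AddMonoidHom.mem_ker, hκ, ker_localKummerMap, zsmulAddGroupHom_natCast, AddMonoidHom.mem_range]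
    simp only [nsmulAddMonoidHom_apply]
    exact ⟨fun ⟨b, hb⟩ ↦ ⟨b, hb.symm⟩, fun ⟨b, hb⟩ ↦ ⟨b, hb.symm⟩⟩
  -- (K2) `κ a = m • κ Q₁`, `m ≡ λ a (mod p^J)`
  have hK2 : ∀ a, ∃ m : ℤ, κ a = m • κ Q₁ ∧ (p : ℤ_[p]) ^ J ∣ lamv a - m := fun a ↦ by
    obtain ⟨m, b, hab, hm⟩ := exists_int_sub_zsmul_eq_prime_pow_nsmul lamv hlamv hsurjv h0v Q₁ hQ₁ J a
    refine ⟨m, ?_, hm⟩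
    rw [← sub_eq_zero, ← map_zsmul, ← map_sub, hK1]
    exact ⟨b, hab⟩
  refine ⟨e, Q₁, he, hQ₁, ?_, ?_, fun Q ↦ hK2 Q⟩
  · -- (K3) order `p^J`
    refine Nat.dvd_antisymm ?_ ?_
    · rw [addOrderOf_dvd_iff_nsmul_eq_zero, ← map_nsmul, hK1]
      exact ⟨Q₁, rfl⟩
    · have h := addOrderOf_nsmul_eq_zero (κ Q₁)
      rw [← map_nsmul, hK1] at h
      obtain ⟨b, hb⟩ := h
      have h2 := (zsmul_mem_prime_pow_nsmul_iff lamv hlamv hsurjv h0v Q₁ hQ₁ J (addOrderOf (κ Q₁) : ℤ)).mp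
        ⟨b, by rw [natCast_zsmul, hb]⟩
      exact_mod_cast h2
  · -- (K4) generation
    intro y hy
    have hy' : y ∈ κ.range := by rw [hκ, range_localKummerMap]; exact hy
    obtain ⟨a, rfl⟩ := AddMonoidHom.mem_range.mp hy'
    obtain ⟨m, hm, -⟩ := hK2 a
    exact AddSubgroup.mem_zmultiples_iff.mpr ⟨m, hm.symm⟩

end OddBlindLocal

end Summit.BirchSwinnertonDyer.BirchSwinnertonDyer.Theorems
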